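import Summits.ValiantsHypothesis.ValiantsHypothesis.Theorems.NcUniqueParseTreeRank
import HarnessLib

/-!
# UPT circuits: the ordered permanent `PERM_{4r}` and the binder shape `perNotNcUptVP`

MODEL: UPT = normal-form UPT circuits typed by a shape (LLS18 Prop 7); the normal-form
conversion (poly blow-up in print) is NOT formalised (predicates of `NcUniqueParseTree`).
Typing survives an input substitution by letters and the scalar `0` (`opTyped_substIn`,
`gates_substIn_typed`); HWY's padded lifting substitution `liftSubst` (`n = 4r`: `z₀` on the
diagonal, `z₁` at `(partner q, q)`, else the scalar `0` — `liftSubst_inr`) maps `PERM_{4r}` to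
`LID_r` (`NcSOSPermanent.perm_lift`), so `NcUniqueParseTreeRank.lidPoly_upt` gives
`ncPerPoly_upt`: every typed circuit computing `PERM_{4r}` (`r ≥ 1`) has size `≥ 2^{r+1}`, and
the binder shape `perNotNcUptVP` (`n = 4m`, `m` from `NcSkewPermanent.skew_growth`).
NON-VACUITY (prose, not formalised): `PERM_n = Σ_σ x_{1σ(1)} ⋯ x_{nσ(n)}` IS computed by a typed
circuit — the left comb `T_n = node (… (node (node leaf leaf) leaf) …) leaf`, one chain of `n - 1`
product gates per permutation (gate `i` of the chain typed by the comb node with `i + 1` leaves,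
multiplying the gate below it, or the letter `x_{1σ(1)}`, by the letter `x_{(i+1)σ(i+1)}`), and one
sum gate typed `[]` adding the `n!` chain tops: size `(n - 1) · n! + 1 ≤ n · n!`. So the class
quantified over in `perNotNcUptVP` is inhabited for every `n`, and the bound is a genuine
super-polynomial lower bound inside it (incomparable with the skew rung `perNotNcSkewVP`).
-/

noncomputable section

namespace Summit.ValiantsHypothesis.ValiantsHypothesis.Theorems.NcUniqueParseTreePermanent

set_option linter.dupNamespace false

open Literature.Computability.AlgebraicComplexity
  Literature.Computability.AlgebraicComplexity.ArithCircuit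
  Summit.ValiantsHypothesis.ValiantsHypothesis.Theorems.NcBlockForms
  Summit.ValiantsHypothesis.ValiantsHypothesis.Theorems.NcCayleyDeterminant
  Summit.ValiantsHypothesis.ValiantsHypothesis.Theorems.NcSOSPermanent
  Summit.ValiantsHypothesis.ValiantsHypothesis.Theorems.NcSkewPermanent
  Summit.ValiantsHypothesis.ValiantsHypothesis.Theorems.NcUniqueParseTree
  Summit.ValiantsHypothesis.ValiantsHypothesis.Theorems.NcUniqueParseTreeRank

universe u v w

section SubstIn

variable {R : Type u} [CommSemiring R] {σ : Type v} {τ : Type w}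

/-- Typing survives an input substitution by letters and the scalar `0` (operands).
[cite: LagardeLimayeSrinivasan2018, §3 Proposition 7] -/
theorem opTyped_substIn {T : Shape} {ty : ℕ → List Bool} {π : List Bool} {u : Operand R σ}
    (hu : OpTyped T ty π u) {φ : σ → τ ⊕ R} (hφ : ∀ x c, φ x = Sum.inr c → c = 0) :
    OpTyped T ty π (u.substIn φ) := by
  cases hu with
  | @gate j h => exact OpTyped.gate h
  | @var x h =>
    show OpTyped T ty π (Operand.ofInput (φ x))
    cases hx : φ x with
    | inl y => exact OpTyped.var h
    | inr c => rw [hφ x c hx]; exact OpTyped.zero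
  | zero => exact OpTyped.zero

/-- Typing survives an input substitution by letters and the scalar `0` (gates).
[cite: LagardeLimayeSrinivasan2018, §3 Proposition 7] -/
theorem gateTyped_substIn {T : Shape} {ty : ℕ → List Bool} {π : List Bool} {g : Gate R σ}
    (hg : GateTyped T ty π g) {φ : σ → τ ⊕ R} (hφ : ∀ x c, φ x = Sum.inr c → c = 0) :
    GateTyped T ty π (g.substIn φ) := by
  cases hg with
  | @sum args h =>
    show GateTyped T ty π (.sum (args.map fun a => (a.1, a.2.substIn φ)))
    refine GateTyped.sum fun a ha => ?_
    obtain ⟨a', ha', rfl⟩ := List.mem_map.1 ha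
    exact opTyped_substIn (h a' ha') hφ
  | @copy u h => exact GateTyped.copy (opTyped_substIn h hφ)
  | @mul u u' l r hπ hu hu' =>
    exact GateTyped.mul hπ (opTyped_substIn hu hφ) (opTyped_substIn hu' hφ)

/-- Typing survives an input substitution by letters and the scalar `0` (all gates of a circuit).
[cite: LagardeLimayeSrinivasan2018, §3 Proposition 7] -/
theorem gates_substIn_typed {T : Shape} {ty : ℕ → List Bool} (P : ArithCircuit R σ)
    (hg : ∀ k (hk : k < P.gates.length), GateTyped T ty (ty k) P.gates[k])
    {φ : σ → τ ⊕ R} (hφ : ∀ x c, φ x = Sum.inr c → c = 0) :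
    ∀ k (hk : k < (P.substIn φ).gates.length), GateTyped T ty (ty k) (P.substIn φ).gates[k] := by
  intro k hk
  simp only [ArithCircuit.substIn, List.getElem_map, List.length_map] at hk ⊢
  exact gateTyped_substIn (hg k hk) hφ

end SubstIn

section Permanent

variable (K : Type u) [Field K]

/-- The scalars of HWY's padded lifting substitution at `n = 4r` are all `0`.
[cite: HrubesWigdersonYehudayoff2010, Lemma C.5] -/
theorem liftSubst_inr {r : ℕ} (x : Fin (4 * r) × Fin (4 * r)) (c : K)
    (h : liftSubst K r (4 * r) x = Sum.inr c) : c = 0 := by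
  unfold liftSubst at h
  by_cases h1 : x.1.val = x.2.val
  · rw [if_pos h1, if_pos x.2.isLt] at h
    cases h
  · rw [if_neg h1] at h
    by_cases h3 : x.1.val = partner r x.2.val
    · rw [if_pos h3] at h
      cases h
    · rw [if_neg h3] at h
      exact (Sum.inr.inj h).symm

/-- **THE ORDERED PERMANENT IS EXPONENTIALLY HARD FOR UPT CIRCUITS** (UPT = normal-form UPT
circuits typed by a shape (LLS18 Prop 7); the normal-form conversion (poly blow-up in print) is
NOT formalised): every typed noncommutative circuit computing `PERM_{4r}` (`r ≥ 1`) has size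
`≥ 2^{r+1}` — substitute by `liftSubst` (typing preserved, size unchanged, value `LID_r` by
`perm_lift`) and apply `lidPoly_upt`. [cite: LagardeLimayeSrinivasan2018, §3 Theorem 10]
[cite: LagardeMalodPerifel2019, §3] [cite: HrubesWigdersonYehudayoff2010, Lemma C.5] -/
theorem ncPerPoly_upt {r : ℕ} (hr : 1 ≤ r) (P : ArithCircuit K (Fin (4 * r) × Fin (4 * r)))
    {T : Shape} {ty : ℕ → List Bool}
    (hg : ∀ k (hk : k < P.gates.length), GateTyped T ty (ty k) P.gates[k])
    (ho : OpTyped T ty [] P.output) (h : P.ncEval = ncPerPoly K (4 * r)) :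
    2 ^ (r + 1) ≤ P.size := by
  have hφ : ∀ x c, liftSubst K r (4 * r) x = Sum.inr c → c = 0 := liftSubst_inr K
  have hQ : (P.substIn (liftSubst K r (4 * r))).ncEval = lidPoly K r := by
    rw [ncEval_substIn, h, perm_lift K (le_refl (4 * r))]
  have := lidPoly_upt K hr (P.substIn (liftSubst K r (4 * r))) (gates_substIn_typed P hg hφ)
    (opTyped_substIn ho hφ) hQ
  rwa [size_substIn] at this

end Permanent

/-- **THE I.O. RUNG IN THE BINDER SHAPE OF `PerNotNcVP`, FOR UPT CIRCUITS** (UPT = normal-form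
UPT circuits typed by a shape (LLS18 Prop 7); the normal-form conversion (poly blow-up in print)
is NOT formalised): for every `c` there is an `n` (`n = 4m`, `(m+1)((4m)^c + c) < 2^m`) such
that no typed noncommutative circuit of size `≤ n^c + c` — of any shape and typing — computes
`PERM_n` over `ℂ`; the class is inhabited by the left-comb circuits of the module docstring.
Says nothing about untyped circuits (`PerNotNcVP` itself stays open).
[cite: LagardeLimayeSrinivasan2018, §3 Theorem 10] [cite: LimayeMalodSrinivasan2016, §7] -/
theorem perNotNcUptVP (c : ℕ) : ∃ n : ℕ, ∀ (P : ArithCircuit ℂ (Fin n × Fin n)) (T : Shape)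
    (ty : ℕ → List Bool), (∀ k (hk : k < P.gates.length), GateTyped T ty (ty k) P.gates[k]) →
    OpTyped T ty [] P.output → P.ncEval = ncPerPoly ℂ n → n ^ c + c < P.size := by
  obtain ⟨m, hm, hlt⟩ := skew_growth c
  refine ⟨4 * m, fun P T ty hg ho h => ?_⟩
  have hle := ncPerPoly_upt ℂ hm P hg ho h
  have hX := Nat.mul_le_mul_right ((4 * m) ^ c + c) (show 1 ≤ m + 1 by omega)
  have h2 : 2 ^ m ≤ 2 ^ (m + 1) := Nat.pow_le_pow_right (by norm_num) (by omega)
  omega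

end Summit.ValiantsHypothesis.ValiantsHypothesis.Theorems.NcUniqueParseTreePermanent

end
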